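import Mathlib
import Summits.Ventures.PercRepro2.WForm
import Summits.Ventures.PercRepro2.WFormProd

/-!
# The W-form is closed under attaching a positively associated branch (blind cell PercRepro2, mine-1 g13)
proofs/MINE1-W-BLOCKS.md, Theorem (W-HIER).

**Theorem `wIneq_hier`**: if `W₁` on `α` satisfies `WIneq D₁ W₁`, `A : α → Prop` is a monotone
attachment predicate that is exclusive for `D₁` (no `D₁`-related pair is active in both copies —
for statuses, `A s₁ = (x ∈ s₁)` and `D₁` = disjointness), `e : β` is a bottom element related to
everything (the empty branch status), and `W₂` is a positively associated probability weight on
`β` (Harris for the observed law of the branch), then the hierarchical weight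
`hierW A e W₁ W₂ (s₁, s₂) = W₁ s₁ · (W₂ s₂ if A s₁ else [s₂ = e])` satisfies `WIneq` for the product
relation. For status laws: a branch hanging at a TEST vertex can be cut off. The proof: on related
pairs the branch is active in at most one copy, the branch sums collapse (`branch_sum_*`), and the
form equals `Q_{W₁}(avg g, avg h)` plus nonnegative covariance corrections (`sum_centred`,
`avg_monotone`).
-/

namespace Summit.Ventures.PercRepro2.WForm

section Hier

variable {R : Type*} [CommRing R] [LinearOrder R] [IsStrictOrderedRing R]
variable {α β : Type*} [Fintype α] [Fintype β] [Preorder α] [Preorder β] [DecidableEq β]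
variable {D₁ : α → α → Prop} [DecidableRel D₁] {D₂ : β → β → Prop} [DecidableRel D₂]

/-- Positive association of a probability weight (Harris for the observed law of a branch). -/
def PA (W : β → R) : Prop :=
  (∀ s, 0 ≤ W s) ∧ (∑ s, W s) = 1 ∧
    ∀ g h : β → R, Monotone g → Monotone h →
      (∑ s, W s * g s) * (∑ s, W s * h s) ≤ ∑ s, W s * (g s * h s)

/-- The branch factor: the branch law if the attachment predicate `A` holds, else the point mass
at the empty branch status `e`. -/
def branch (A : α → Prop) [DecidablePred A] (e : β) (W₂ : β → R) (s₁ : α) (s₂ : β) : R :=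
  if A s₁ then W₂ s₂ else if s₂ = e then 1 else 0

/-- The hierarchical weight `W₁ s₁ · branch s₁ s₂`. -/
def hierW (A : α → Prop) [DecidablePred A] (e : β) (W₁ : α → R) (W₂ : β → R) (p : α × β) : R :=
  W₁ p.1 * branch A e W₂ p.1 p.2

/-- The branch-averaged function: `∑ W₂ s₂ · g (s₁, s₂)` when the branch is active, `g (s₁, e)`
otherwise. -/
def avg (A : α → Prop) [DecidablePred A] (e : β) (W₂ : β → R) (g : α × β → R) (s₁ : α) : R :=
  if A s₁ then ∑ s₂, W₂ s₂ * g (s₁, s₂) else g (s₁, e)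

omit [Fintype α] [Fintype β] [Preorder α] [Preorder β] [LinearOrder R] [IsStrictOrderedRing R] in
/-- The coefficient of a hierarchical weight: the first-factor coefficient times the branch factors
on related branch statuses. -/
lemma coef_hier (A : α → Prop) [DecidablePred A] (e : β) (W₁ : α → R) (W₂ : β → R)
    (p q : α × β) :
    coef (prodRel D₁ D₂) (hierW A e W₁ W₂) p q =
      coef D₁ W₁ p.1 q.1 *
        ((if D₂ p.2 q.2 then 1 else 0) * (branch A e W₂ p.1 p.2 * branch A e W₂ q.1 q.2)) := by
  unfold coef prodRel hierW
  by_cases h1 : D₁ p.1 q.1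
  · by_cases h2 : D₂ p.2 q.2
    · rw [if_pos ⟨h1, h2⟩, if_pos h1, if_pos h2]; ring
    · rw [if_neg (fun h => h2 h.2), if_neg h2]; ring
  · rw [if_neg (fun h => h1 h.1), if_neg h1, zero_mul]

omit [Preorder α] [Preorder β] [LinearOrder R] [IsStrictOrderedRing R] in
/-- The W-form of a hierarchical weight as a kernel sum over the first factor. -/
lemma Q_hier_eq (A : α → Prop) [DecidablePred A] (e : β) (W₁ : α → R) (W₂ : β → R)
    (g h : α × β → R) :
    Q (prodRel D₁ D₂) (hierW A e W₁ W₂) g h =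
      S D₁ W₁ (fun s₁ t₁ => ∑ s₂, ∑ t₂, (if D₂ s₂ t₂ then 1 else 0) *
        (branch A e W₂ s₁ s₂ * branch A e W₂ t₁ t₂) *
        ((g (s₁, s₂) - g (t₁, t₂)) * (h (s₁, s₂) - h (t₁, t₂)))) := by
  unfold Q S
  simp only [Finset.mul_sum]
  rw [Fintype.sum_prod_type]
  refine Finset.sum_congr rfl fun s₁ _ => ?_
  calc ∑ s₂, ∑ q : α × β, coef (prodRel D₁ D₂) (hierW A e W₁ W₂) (s₁, s₂) q *
          ((g (s₁, s₂) - g q) * (h (s₁, s₂) - h q))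
      = ∑ s₂, ∑ t₁, ∑ t₂, coef (prodRel D₁ D₂) (hierW A e W₁ W₂) (s₁, s₂) (t₁, t₂) *
          ((g (s₁, s₂) - g (t₁, t₂)) * (h (s₁, s₂) - h (t₁, t₂))) :=
        Finset.sum_congr rfl fun s₂ _ => Fintype.sum_prod_type _
    _ = ∑ t₁, ∑ s₂, ∑ t₂, coef (prodRel D₁ D₂) (hierW A e W₁ W₂) (s₁, s₂) (t₁, t₂) *
          ((g (s₁, s₂) - g (t₁, t₂)) * (h (s₁, s₂) - h (t₁, t₂))) := Finset.sum_comm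
    _ = ∑ t₁, ∑ s₂, ∑ t₂, coef D₁ W₁ s₁ t₁ * ((if D₂ s₂ t₂ then 1 else 0) *
          (branch A e W₂ s₁ s₂ * branch A e W₂ t₁ t₂) *
          ((g (s₁, s₂) - g (t₁, t₂)) * (h (s₁, s₂) - h (t₁, t₂)))) :=
        Finset.sum_congr rfl fun t₁ _ => Finset.sum_congr rfl fun s₂ _ =>
          Finset.sum_congr rfl fun t₂ _ => by rw [coef_hier]; ring

omit [Preorder α] [LinearOrder R] [IsStrictOrderedRing R] in
/-- Kernel sums only see related pairs. -/
lemma S_congr_rel (D : α → α → Prop) [DecidableRel D] (W : α → R) {X Y : α → α → R}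
    (h : ∀ s t, D s t → X s t = Y s t) : S D W X = S D W Y := by
  unfold S
  refine Finset.sum_congr rfl fun s _ => Finset.sum_congr rfl fun t _ => ?_
  unfold coef
  by_cases hst : D s t
  · rw [h s t hst]
  · rw [if_neg hst, zero_mul, zero_mul]

omit [Fintype α] [Preorder α] [Preorder β] [LinearOrder R] [IsStrictOrderedRing R] in
/-- A one-sided branch sum: when only the first copy is active, the second copy sits at `e`. -/
lemma branch_sum_active (A : α → Prop) [DecidablePred A] (e : β) (W₂ : β → R)
    (hDe : ∀ b, D₂ b e) (s₁ t₁ : α) (hs : A s₁) (ht : ¬ A t₁) (L : β → β → R) :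
    (∑ s₂, ∑ t₂, (if D₂ s₂ t₂ then 1 else 0) *
        (branch A e W₂ s₁ s₂ * branch A e W₂ t₁ t₂) * L s₂ t₂) =
      ∑ s₂, W₂ s₂ * L s₂ e := by
  refine Finset.sum_congr rfl fun s₂ _ => ?_
  rw [Finset.sum_eq_single e]
  · unfold branch
    rw [if_pos (hDe s₂), if_pos hs, if_neg ht, if_pos rfl]; ring
  · intro t₂ _ hne
    unfold branch
    rw [if_neg ht, if_neg hne]; ring
  · intro h; exact absurd (Finset.mem_univ e) h

omit [Fintype α] [Preorder α] [Preorder β] [LinearOrder R] [IsStrictOrderedRing R] in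
/-- The mirror case: only the second copy is active. -/
lemma branch_sum_active' (A : α → Prop) [DecidablePred A] (e : β) (W₂ : β → R)
    (hDe : ∀ b, D₂ e b) (s₁ t₁ : α) (hs : ¬ A s₁) (ht : A t₁) (L : β → β → R) :
    (∑ s₂, ∑ t₂, (if D₂ s₂ t₂ then 1 else 0) *
        (branch A e W₂ s₁ s₂ * branch A e W₂ t₁ t₂) * L s₂ t₂) =
      ∑ t₂, W₂ t₂ * L e t₂ := by
  rw [Finset.sum_eq_single e]
  · refine Finset.sum_congr rfl fun t₂ _ => ?_
    unfold branch
    rw [if_pos (hDe t₂), if_neg hs, if_pos rfl, if_pos ht]; ring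
  · intro s₂ _ hne
    refine Finset.sum_eq_zero fun t₂ _ => ?_
    unfold branch
    rw [if_neg hs, if_neg hne]; ring
  · intro h; exact absurd (Finset.mem_univ e) h

omit [Fintype α] [Preorder α] [Preorder β] [LinearOrder R] [IsStrictOrderedRing R] in
/-- Neither copy active: both sit at `e`. -/
lemma branch_sum_inactive (A : α → Prop) [DecidablePred A] (e : β) (W₂ : β → R)
    (hDe : ∀ b, D₂ b e) (s₁ t₁ : α) (hs : ¬ A s₁) (ht : ¬ A t₁) (L : β → β → R) :
    (∑ s₂, ∑ t₂, (if D₂ s₂ t₂ then 1 else 0) *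
        (branch A e W₂ s₁ s₂ * branch A e W₂ t₁ t₂) * L s₂ t₂) = L e e := by
  rw [Finset.sum_eq_single e]
  · rw [Finset.sum_eq_single e]
    · unfold branch
      rw [if_pos (hDe e), if_neg hs, if_neg ht, if_pos rfl]; ring
    · intro t₂ _ hne
      unfold branch
      rw [if_neg ht, if_neg hne]; ring
    · intro h; exact absurd (Finset.mem_univ e) h
  · intro s₂ _ hne
    refine Finset.sum_eq_zero fun t₂ _ => ?_
    unfold branch
    rw [if_neg hs, if_neg hne]; ring
  · intro h; exact absurd (Finset.mem_univ e) h

omit [Fintype α] [Preorder β] [DecidableEq β] [LinearOrder R] [IsStrictOrderedRing R] in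
/-- Expanding a centred second moment against a probability weight. -/
lemma sum_centred (W₂ : β → R) (hW : (∑ s, W₂ s) = 1) (u v : β → R) (c d : R) :
    (∑ s, W₂ s * ((u s - c) * (v s - d))) =
      ((∑ s, W₂ s * (u s * v s)) - (∑ s, W₂ s * u s) * (∑ s, W₂ s * v s)) +
        ((∑ s, W₂ s * u s) - c) * ((∑ s, W₂ s * v s) - d) := by
  have e1 : (∑ s, W₂ s * ((u s - c) * (v s - d))) =
      (∑ s, W₂ s * (u s * v s)) - c * (∑ s, W₂ s * v s) - d * (∑ s, W₂ s * u s) +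
        c * d * (∑ s, W₂ s) := by
    rw [Finset.mul_sum, Finset.mul_sum, Finset.mul_sum, ← Finset.sum_sub_distrib,
      ← Finset.sum_sub_distrib, ← Finset.sum_add_distrib]
    refine Finset.sum_congr rfl fun s _ => ?_
    ring
  rw [e1, hW]
  ring

omit [Fintype α] [DecidableEq β] in
/-- Monotonicity of the branch-averaged function. -/
lemma avg_monotone (A : α → Prop) [DecidablePred A] (hA : ∀ s t, s ≤ t → A s → A t) (e : β)
    (he : ∀ b, e ≤ b) {W₂ : β → R} (hW0 : ∀ s, 0 ≤ W₂ s) (hW1 : (∑ s, W₂ s) = 1)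
    {g : α × β → R} (hg : Monotone g) : Monotone (avg A e W₂ g) := by
  intro s₁ t₁ hst
  unfold avg
  by_cases hs : A s₁
  · have ht : A t₁ := hA s₁ t₁ hst hs
    rw [if_pos hs, if_pos ht]
    exact Finset.sum_le_sum fun s₂ _ =>
      mul_le_mul_of_nonneg_left (hg (Prod.mk_le_mk.mpr ⟨hst, le_refl s₂⟩)) (hW0 s₂)
  · rw [if_neg hs]
    by_cases ht : A t₁
    · rw [if_pos ht]
      calc g (s₁, e) = (∑ s₂, W₂ s₂) * g (s₁, e) := by rw [hW1, one_mul]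
        _ = ∑ s₂, W₂ s₂ * g (s₁, e) := Finset.sum_mul _ _ _
        _ ≤ ∑ s₂, W₂ s₂ * g (t₁, s₂) := Finset.sum_le_sum fun s₂ _ =>
            mul_le_mul_of_nonneg_left (hg (Prod.mk_le_mk.mpr ⟨hst, he s₂⟩)) (hW0 s₂)
    · rw [if_neg ht]
      exact hg (Prod.mk_le_mk.mpr ⟨hst, le_refl e⟩)

/-- **(W-HIER)**: the W-inequality is closed under attaching a positively associated branch at
an attachment predicate `A` that is monotone and exclusive for `D₁` (no related pair is active in
both copies) — for graphs, a branch hanging at a test vertex. -/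
theorem wIneq_hier (A : α → Prop) [DecidablePred A] (hA : ∀ s t, s ≤ t → A s → A t)
    (hex : ∀ s t, D₁ s t → A s → A t → False) (e : β) (he : ∀ b, e ≤ b)
    (hDe : ∀ b, D₂ b e) (hDe' : ∀ b, D₂ e b) {W₁ : α → R} {W₂ : β → R}
    (h₁ : WIneq D₁ W₁) (h₂ : PA W₂) : WIneq (prodRel D₁ D₂) (hierW A e W₁ W₂) := by
  obtain ⟨hW0, hW1, hPA⟩ := h₂
  refine ⟨fun p => ?_, ?_⟩
  · unfold hierW branch
    refine mul_nonneg (h₁.1 p.1) ?_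
    by_cases hAp : A p.1
    · rw [if_pos hAp]; exact hW0 p.2
    · rw [if_neg hAp]
      by_cases hpe : p.2 = e
      · rw [if_pos hpe]; exact (zero_le_one : (0 : R) ≤ 1)
      · rw [if_neg hpe]
  intro g h hg hh
  rw [Q_hier_eq]
  -- the covariance correction on active pairs
  let cov : α → R := fun s₁ =>
    (∑ s₂, W₂ s₂ * (g (s₁, s₂) * h (s₁, s₂))) -
      (∑ s₂, W₂ s₂ * g (s₁, s₂)) * (∑ s₂, W₂ s₂ * h (s₁, s₂))
  have hcov : ∀ s₁, 0 ≤ cov s₁ := fun s₁ => by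
    simp only [cov]
    rw [sub_nonneg]
    exact hPA _ _ (fun a b hab => hg (Prod.mk_le_mk.mpr ⟨le_refl s₁, hab⟩))
      (fun a b hab => hh (Prod.mk_le_mk.mpr ⟨le_refl s₁, hab⟩))
  let corr : α → α → R := fun s₁ t₁ =>
    (if A s₁ then cov s₁ else 0) + (if A t₁ then cov t₁ else 0)
  have hcorr : ∀ s₁ t₁, 0 ≤ corr s₁ t₁ := fun s₁ t₁ => by
    simp only [corr]
    refine add_nonneg ?_ ?_ <;> split_ifs <;> first | exact hcov _ | exact le_refl 0
  have key : S D₁ W₁ (fun s₁ t₁ => ∑ s₂, ∑ t₂, (if D₂ s₂ t₂ then 1 else 0) *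
        (branch A e W₂ s₁ s₂ * branch A e W₂ t₁ t₂) *
        ((g (s₁, s₂) - g (t₁, t₂)) * (h (s₁, s₂) - h (t₁, t₂)))) =
      S D₁ W₁ (fun s₁ t₁ => (avg A e W₂ g s₁ - avg A e W₂ g t₁) *
        (avg A e W₂ h s₁ - avg A e W₂ h t₁) + corr s₁ t₁) := by
    apply S_congr_rel
    intro s₁ t₁ hst
    by_cases hs : A s₁
    · have ht : ¬ A t₁ := fun ht => hex s₁ t₁ hst hs ht
      rw [branch_sum_active A e W₂ hDe s₁ t₁ hs ht]
      simp only [avg, corr, cov, if_pos hs, if_neg ht, add_zero]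
      rw [sum_centred W₂ hW1 (fun s₂ => g (s₁, s₂)) (fun s₂ => h (s₁, s₂)) (g (t₁, e)) (h (t₁, e))]
      ring
    · by_cases ht : A t₁
      · rw [branch_sum_active' A e W₂ hDe' s₁ t₁ hs ht]
        simp only [avg, corr, cov, if_neg hs, if_pos ht, zero_add]
        have := sum_centred W₂ hW1 (fun t₂ => g (t₁, t₂)) (fun t₂ => h (t₁, t₂)) (g (s₁, e))
          (h (s₁, e))
        have e2 : (∑ t₂, W₂ t₂ * ((g (s₁, e) - g (t₁, t₂)) * (h (s₁, e) - h (t₁, t₂)))) =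
            ∑ t₂, W₂ t₂ * ((g (t₁, t₂) - g (s₁, e)) * (h (t₁, t₂) - h (s₁, e))) :=
          Finset.sum_congr rfl fun t₂ _ => by ring
        rw [e2, this]
        ring
      · rw [branch_sum_inactive A e W₂ hDe s₁ t₁ hs ht]
        simp only [avg, corr, if_neg hs, if_neg ht, add_zero]
  rw [key, S_add]
  refine add_nonneg ?_ (S_nonneg D₁ h₁.1 hcorr)
  exact h₁.2 _ _ (avg_monotone A hA e he hW0 hW1 hg) (avg_monotone A hA e he hW0 hW1 hh)

end Hier

end Summit.Ventures.PercRepro2.WForm
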